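/-
Copyright: cell `pub-balaban-gaps` (G2), seat ne6 (row NE7b), `prover-pub-balaban-gaps-ne6-g14-0`, on this seat's `CompactFibreWindowSU2Rate` (V26, gen 14) ∕
`CompactFibreWindowSU2` (V19, gen 11) and leaf-01 g80's `CompactFibreRelative` (OWNER lineage `t4-ne7b-p1` g106's `CompactFibreCarrier`). Project licence.
-/
import Summits.QuantumFields.BalabanUV.T4Continuum.Spine.NE7b.CompactFibreRelative
import Summits.QuantumFields.BalabanUV.T4Continuum.Spine.NE7b.CompactFibreWindowSU2
import Mathlib.MeasureTheory.Integral.Pi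

/-!
# THE PROFILE (INTEGRATED-DENOMINATOR) VOLUME LETTER: `−log ∫_{W_η} e^{−q} dκ ≤ q₀ + b` for a profile `q ≤ q₀` on the inner window of radius² `σ ≤ η`
# and ANY inner-window letter `b ≥ −log κ(Π W_σ)` (V26: `#bonds·((3∕2)·log σ⁻¹ + log 160)`) — `SU(2)` MODEL of [B16] (1.2)∕(1.10)'s `E_k(Λ)` (row NE7b; [folklore])

Cell `pub-balaban-gaps` (G2 spine census, V27) for the `pub-balaban` T⁴ crux NE7b (`T4WeightBudget.RelWeightBound`; the cell's OWN estimate — NOT PRINTED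
in [Bałaban 1983–89], NOT PROVED).  Crux-route MODEL work under `Spine/NE7b/`; NOTHING of Bałaban's is named as a hypothesis or asserted; no `def`; zero
`sorry`.  Imports (BUILT oleans only, so that this file does not wait in the gate's retry lane for V26's olean): V19 `…CompactFibreWindowSU2`
(`measurableSet_traceWindow`, `pi_traceWindow_toReal_pos`, `norm_su2Quat_sub_one_sq`, the rate-`2` letter `neg_log_pi_traceWindow_le`), leaf-01's
`…CompactFibreRelative` (`relFibre_moment_le_of_centredProfile` — the fibrewise-relative sandwich with an INTEGRATED profile in the denominator), Mathlib's
`MeasureTheory.Integral.Pi`.  The window-volume letter enters as an ABSTRACT hypothesis `b ≥ −log κ(Π_b W_σ)`; V26 `…CompactFibreWindowSU2Rate`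
(`neg_log_pi_traceWindow_le_sharp`, filed alongside) supplies `b = #bonds·((3∕2)·log σ⁻¹ + log 160)` by a one-line application — the rate-`3∕2` readings quoted
below — and V19 supplies `b = #bonds·(2 log σ⁻¹ + log 16)` today (§6).

WHY.  [Balaban1989LargeFieldII] p. 356 (1.2) expands the creation step's denominator about its minimum `U₀` and INTEGRATES the Gaussian over the window
«`χ({|B′| < M₀g_k⁻¹ε_k})`», whence p. 358 (1.10) «`E_k(Λ) = (−½d(𝔤)log g_k⁻² + log σ₀)|Λ^{(k)}∖G₀|`»: the letter is the log of a Gaussian integral of width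
`∝ g_k` per degree of freedom.  V25 §2b typed this shape with the letter left as `∫_W e^{−q} dκ`; here it is valued by the window letter: profile `≤ q₀` on the
inner window of radius² `σ` (quadratic trace profile `(2σ)⁻¹Σ_b(2 − Re tr v_b)`, the model of `½g_k⁻²|B′|²` at `σ = g_k²`: `q₀ = #bonds∕2`) ⟹
`−log ∫_{W_η} e^{−q} dκ ≤ q₀ + b`; with V26's `b`, at `σ = g²`, the per-bond letter is `(3∕2)·log g⁻² + (log 160 + ½)` — print's `½d(𝔤)·log g_k⁻²`, `d(𝔤) = 3`.

WHAT.  §1 (any finite measure space) `setIntegral_exp_neg_ge_of_le_on`: `W′ ⊆ W`, `q ≤ q₀` on `W′`, `e^{−q}` integrable on `W` ⊢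
`e^{−q₀}·κ(W′) ≤ ∫_W e^{−q} dκ`; `neg_log_setIntegral_exp_neg_le`: `⊢ −log ∫_W e^{−q} dκ ≤ q₀ − log κ(W′)` (`κ(W′) > 0`).  §2 (`bonds → SU(2)`, product Haar)
**`neg_log_profileVolume_le`**: `0 < σ ≤ ¼`, `σ ≤ η`, `q ≤ q₀` on `Π_b W_σ`, `−log κ(Π W_σ) ≤ b` ⊢ `−log ∫_{Π W_η} e^{−q} dκ ≤ q₀ + b`.  §3 the quadratic
trace profile: `measurable_traceDeficitSum`, `quadProfile_le_on_innerWindow` (`≤ #bonds∕2` on `Π W_σ`),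
`integrable_exp_neg_quadProfile`, and **`neg_log_quadProfileVolume_le`**: `−log ∫_{Π W_η} exp(−(2σ)⁻¹Σ_b(2 − Re tr v_b)) dκ ≤ #bonds∕2 + b`;
§3b `profileVolume_eq_pow` ∕ `quadProfileVolume_eq_pow` (EXACT factorisation: the letter is ADDITIVE over the bonds — print's «per site») and `le_neg_log_profileVolume`
(the other side: any lower letter `b′ ≤ −log κ(Π W_η)` gives `b′ ≤ −log ∫ …` for `q ≥ 0`).
§4 the junction with leaf-01's profile sandwich — **`creationPrice_SU2_profile_valued`**: V25 §2b's price `e^{−(λ∕2)δ′²}·(∫F dκ ∕ ∫_W e^{−q} dκ)` with the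
denominator's letter folded in: `∫ F·w·e^{−I} ≤ exp(−(λ∕2)δ′² + q₀ + b)·(∫F dκ)·∫ G·w·e^{−I}`, and at the quadratic trace profile
**`creationPrice_SU2_quadProfile_valued`**: `exp(−(λ∕2)δ′² + #bonds∕2 + b)`.  §5: the Gaussian
trace action `I = m₀ + (2σ)⁻¹Σ_b(2 − Re tr((U₀ b)⁻¹x_b))` meets §4's `hconv` (λ = σ⁻¹) and `hIprof` WITH EQUALITY (`quadAction_hconv`, `quadAction_hIprof`) — a non-vacuous
instance of the action hypotheses.  §6 BY VALUE TODAY: `neg_log_quadProfileVolume_le_rate2` (V19's letter: `≤ #bonds·(2 log σ⁻¹ + log 16 + ½)`);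
the rate-`3∕2` form `≤ #bonds·((3∕2)·log σ⁻¹ + log 160 + ½)` is the same one-liner with V26's `neg_log_pi_traceWindow_le_sharp` (to be appended once V26's olean exists).

HONEST REMARKS.  MODEL only (`SU(2)`, product Haar, trace windows, an abstract profile `q`); [folklore] measure arithmetic.  Nothing of Bałaban's asserted
or valued beyond quoting (1.2)∕(1.10); the rate-`3∕2` readings are V26's (chair-passed, filed alongside; NOT imported here); that print's profile `½⟨H_{1,k}B′, Δ₁(ζ₀)H_{1,k}B′⟩` is `≤ q₀ = O(#bonds)` on the radius-`g_k` window, which `η(g_k)`,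
`σ(g_k)` the step carries, and that its carrier IS this one are (A3) ∕ (A1c), NC-NE7b-α UNRULED; `160` is V26's constant, not print's `σ₀`.  BY-NAME EFFECT ON
THE WALL: NONE.  NE7b NOT PRINTED ∕ NOT PROVED; spine PROVED 0∕9; rung (B)+1 on ONE finite T⁴ — NOT infinite volume, NOT the mass gap, NOT Clay.
HONEST DEPENDENCY: continuum YM on T⁴ ⇐ BetaPertH ∧ nine spine estimates (0/9 proved); BetaPertH ⇐ (D1) ∧ (D4) ∧ CAP+tail; G-an2-4 gates asym, D1 and
NE2/3/4.  This file changes none of it.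
-/

set_option autoImplicit false

noncomputable section

open MeasureTheory Real Finset
open Literature.MathematicalPhysics.QuantumFieldTheory (haarProbability)
open Literature.MathematicalPhysics.QuantumLattice (su2Quat)
open Summit.QuantumFields.BalabanUV.T4Continuum.NE7b.CompactFibreRelative (relFibre_moment_le_of_centredProfile)
open Summit.QuantumFields.BalabanUV.T4Continuum.NE7b.CompactFibreWindowSU2 (measurableSet_traceWindow pi_traceWindow_toReal_pos norm_su2Quat_sub_one_sq
  neg_log_pi_traceWindow_le)

namespace Summit.QuantumFields.BalabanUV.T4Continuum.NE7b.CompactFibreProfileVolumeSU2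

/-! ## §1 An integrated profile is at least `e^{−sup}` times the mass of any inner set -/

section Generic

variable {K : Type*} [MeasurableSpace K] (κ : Measure K) [IsFiniteMeasure κ]

/-- **INNER-SET LOWER BOUND**: `W′ ⊆ W` measurable, `q ≤ q₀` on `W′`, `e^{−q}` integrable on `W` ⊢ `e^{−q₀}·κ(W′) ≤ ∫_W e^{−q} dκ`. [folklore] -/
theorem setIntegral_exp_neg_ge_of_le_on {W W' : Set K} {q : K → ℝ} {q₀ : ℝ} (hW' : MeasurableSet W') (hsub : W' ⊆ W)
    (hq : ∀ v ∈ W', q v ≤ q₀) (hint : IntegrableOn (fun v => exp (-q v)) W κ) :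
    exp (-q₀) * κ.real W' ≤ ∫ v in W, exp (-q v) ∂κ :=
  calc exp (-q₀) * κ.real W' ≤ ∫ v in W', exp (-q v) ∂κ :=
        setIntegral_ge_of_const_le_real hW' (measure_ne_top _ _) (fun v hv => Real.exp_le_exp.2 (by linarith [hq v hv]))
          (hint.mono_set hsub)
    _ ≤ ∫ v in W, exp (-q v) ∂κ :=
        setIntegral_mono_set hint (Filter.Eventually.of_forall fun v => (exp_pos _).le) hsub.eventuallyLE

/-- Hence the PROFILE VOLUME LETTER is controlled by the sup on the inner set and its volume letter: `−log ∫_W e^{−q} dκ ≤ q₀ − log κ(W′)`. [folklore] -/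
theorem neg_log_setIntegral_exp_neg_le {W W' : Set K} {q : K → ℝ} {q₀ : ℝ} (hW' : MeasurableSet W') (hsub : W' ⊆ W)
    (hq : ∀ v ∈ W', q v ≤ q₀) (hint : IntegrableOn (fun v => exp (-q v)) W κ) (hpos : 0 < κ.real W') :
    -Real.log (∫ v in W, exp (-q v) ∂κ) ≤ q₀ - Real.log (κ.real W') := by
  have h := setIntegral_exp_neg_ge_of_le_on κ hW' hsub hq hint
  have hpos' : 0 < exp (-q₀) * κ.real W' := by positivity
  have hlog := Real.log_le_log hpos' h
  rw [Real.log_mul (exp_pos _).ne' hpos.ne', Real.log_exp] at hlog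
  linarith

/-- The integrated profile is positive as soon as the inner set has positive mass. [folklore] -/
theorem setIntegral_exp_neg_pos_of_le_on {W W' : Set K} {q : K → ℝ} {q₀ : ℝ} (hW' : MeasurableSet W') (hsub : W' ⊆ W)
    (hq : ∀ v ∈ W', q v ≤ q₀) (hint : IntegrableOn (fun v => exp (-q v)) W κ) (hpos : 0 < κ.real W') :
    0 < ∫ v in W, exp (-q v) ∂κ :=
  lt_of_lt_of_le (by positivity) (setIntegral_exp_neg_ge_of_le_on κ hW' hsub hq hint)

end Generic

/-! ## §2 The `SU(2)` product fibre: the profile letter at rate `3∕2` in the inner radius² `σ` -/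

section SU2

variable {B : Type*} [Fintype B]

omit [Fintype B] in
/-- Windows are monotone in the half-width: `Π_b W_σ ⊆ Π_b W_η` for `σ ≤ η`. [folklore] -/
theorem pi_traceWindow_mono {σ η : ℝ} (h : σ ≤ η) :
    (Set.univ.pi fun _ : B => {U : Matrix.specialUnitaryGroup (Fin 2) ℂ | 2 - ((U : Matrix (Fin 2) (Fin 2) ℂ).trace).re ≤ σ}) ⊆
      (Set.univ.pi fun _ : B => {U : Matrix.specialUnitaryGroup (Fin 2) ℂ | 2 - ((U : Matrix (Fin 2) (Fin 2) ℂ).trace).re ≤ η}) :=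
  Set.pi_mono fun _ _ _ hU => le_trans hU h

/-- **THE PROFILE VOLUME LETTER AT PRINT'S RATE** (`SU(2)` MODEL): for the product Haar measure `κ` on `bonds → SU(2)`, windows `Π_b W_η ⊇ Π_b W_σ`
(`0 < σ ≤ ¼`, `σ ≤ η`), a profile `q` with `q ≤ q₀` on the inner window and `e^{−q}` integrable on the outer one, and ANY volume letter of the
inner window `b ≥ −log κ(Π_b W_σ)` (V19: `#bonds·(2 log σ⁻¹ + log 16)`; V26: `#bonds·((3∕2)·log σ⁻¹ + log 160)`): `−log ∫_{Π W_η} e^{−q} dκ ≤ q₀ + b`. [folklore] -/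
theorem neg_log_profileVolume_le {σ η q₀ b : ℝ} (hσ0 : 0 < σ) (hσ : σ ≤ 1 / 4) (hση : σ ≤ η)
    (hvol : -Real.log ((Measure.pi fun _ : B => haarProbability (Matrix.specialUnitaryGroup (Fin 2) ℂ))
        (Set.univ.pi fun _ : B => {U : Matrix.specialUnitaryGroup (Fin 2) ℂ | 2 - ((U : Matrix (Fin 2) (Fin 2) ℂ).trace).re ≤ σ})).toReal ≤ b)
    (q : (B → Matrix.specialUnitaryGroup (Fin 2) ℂ) → ℝ)
    (hq : ∀ v ∈ (Set.univ.pi fun _ : B => {U : Matrix.specialUnitaryGroup (Fin 2) ℂ | 2 - ((U : Matrix (Fin 2) (Fin 2) ℂ).trace).re ≤ σ}), q v ≤ q₀)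
    (hint : IntegrableOn (fun v => exp (-q v))
      (Set.univ.pi fun _ : B => {U : Matrix.specialUnitaryGroup (Fin 2) ℂ | 2 - ((U : Matrix (Fin 2) (Fin 2) ℂ).trace).re ≤ η})
      (Measure.pi fun _ : B => haarProbability (Matrix.specialUnitaryGroup (Fin 2) ℂ))) :
    -Real.log (∫ v in (Set.univ.pi fun _ : B => {U : Matrix.specialUnitaryGroup (Fin 2) ℂ | 2 - ((U : Matrix (Fin 2) (Fin 2) ℂ).trace).re ≤ η}),
        exp (-q v) ∂(Measure.pi fun _ : B => haarProbability (Matrix.specialUnitaryGroup (Fin 2) ℂ))) ≤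
      q₀ + b := by
  set κ : Measure (B → Matrix.specialUnitaryGroup (Fin 2) ℂ) := Measure.pi fun _ : B => haarProbability (Matrix.specialUnitaryGroup (Fin 2) ℂ)
    with hκ
  set W' : Set (B → Matrix.specialUnitaryGroup (Fin 2) ℂ) :=
    Set.univ.pi fun _ : B => {U : Matrix.specialUnitaryGroup (Fin 2) ℂ | 2 - ((U : Matrix (Fin 2) (Fin 2) ℂ).trace).re ≤ σ} with hW'
  have hW'm : MeasurableSet W' := MeasurableSet.univ_pi fun _ => measurableSet_traceWindow σ
  have hpos : 0 < κ.real W' := by rw [measureReal_def]; exact pi_traceWindow_toReal_pos hσ0 hσ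
  have hvol' : -Real.log (κ.real W') ≤ b := by rw [measureReal_def]; exact hvol
  have h := neg_log_setIntegral_exp_neg_le κ hW'm (pi_traceWindow_mono hση) hq hint hpos
  linarith

/-- Positivity of the integrated profile under the same hypotheses (the `hqpos` input of leaf-01's `relFibre_moment_le_of_centredProfile`). [folklore] -/
theorem profileVolume_pos {σ η q₀ : ℝ} (hσ0 : 0 < σ) (hσ : σ ≤ 1 / 4) (hση : σ ≤ η)
    (q : (B → Matrix.specialUnitaryGroup (Fin 2) ℂ) → ℝ)
    (hq : ∀ v ∈ (Set.univ.pi fun _ : B => {U : Matrix.specialUnitaryGroup (Fin 2) ℂ | 2 - ((U : Matrix (Fin 2) (Fin 2) ℂ).trace).re ≤ σ}), q v ≤ q₀)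
    (hint : IntegrableOn (fun v => exp (-q v))
      (Set.univ.pi fun _ : B => {U : Matrix.specialUnitaryGroup (Fin 2) ℂ | 2 - ((U : Matrix (Fin 2) (Fin 2) ℂ).trace).re ≤ η})
      (Measure.pi fun _ : B => haarProbability (Matrix.specialUnitaryGroup (Fin 2) ℂ))) :
    0 < ∫ v in (Set.univ.pi fun _ : B => {U : Matrix.specialUnitaryGroup (Fin 2) ℂ | 2 - ((U : Matrix (Fin 2) (Fin 2) ℂ).trace).re ≤ η}),
        exp (-q v) ∂(Measure.pi fun _ : B => haarProbability (Matrix.specialUnitaryGroup (Fin 2) ℂ)) :=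
  setIntegral_exp_neg_pos_of_le_on _ (MeasurableSet.univ_pi fun _ => measurableSet_traceWindow σ) (pi_traceWindow_mono hση) hq hint
    (by rw [measureReal_def]; exact pi_traceWindow_toReal_pos hσ0 hσ)

/-! ## §3 The quadratic trace profile `(2σ)⁻¹·Σ_b (2 − Re tr v_b)` — the model of `½g_k⁻²|B′|²` at `σ = g_k²` -/

/-- The summed trace deficit is measurable on the product (bondwise: continuity on `SU(2)` and `measurable_pi_apply`). [folklore] -/
theorem measurable_traceDeficitSum :
    Measurable fun v : B → Matrix.specialUnitaryGroup (Fin 2) ℂ => ∑ b, (2 - (((v b : Matrix.specialUnitaryGroup (Fin 2) ℂ) : Matrix (Fin 2) (Fin 2) ℂ).trace).re) := by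
  refine Finset.measurable_sum _ fun b _ => measurable_const.sub ?_
  exact ((Complex.continuous_re.comp (continuous_subtype_val.matrix_trace)).measurable).comp (measurable_pi_apply b)

/-- On the inner window `Π_b W_σ` the quadratic trace profile is at most `#bonds∕2` (`σ > 0`). [folklore] -/
theorem quadProfile_le_on_innerWindow {σ : ℝ} (hσ0 : 0 < σ) {v : B → Matrix.specialUnitaryGroup (Fin 2) ℂ}
    (hv : v ∈ (Set.univ.pi fun _ : B => {U : Matrix.specialUnitaryGroup (Fin 2) ℂ | 2 - ((U : Matrix (Fin 2) (Fin 2) ℂ).trace).re ≤ σ})) :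
    (2 * σ)⁻¹ * ∑ b, (2 - (((v b : Matrix.specialUnitaryGroup (Fin 2) ℂ) : Matrix (Fin 2) (Fin 2) ℂ).trace).re) ≤ (Fintype.card B : ℝ) / 2 := by
  have hsum : ∑ b, (2 - (((v b : Matrix.specialUnitaryGroup (Fin 2) ℂ) : Matrix (Fin 2) (Fin 2) ℂ).trace).re) ≤ ∑ _b : B, σ :=
    Finset.sum_le_sum fun b _ => by simpa using hv b (Set.mem_univ b)
  rw [Finset.sum_const, Finset.card_univ, nsmul_eq_mul] at hsum
  calc (2 * σ)⁻¹ * ∑ b, (2 - (((v b : Matrix.specialUnitaryGroup (Fin 2) ℂ) : Matrix (Fin 2) (Fin 2) ℂ).trace).re)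
      ≤ (2 * σ)⁻¹ * ((Fintype.card B : ℝ) * σ) := mul_le_mul_of_nonneg_left hsum (by positivity)
    _ = (Fintype.card B : ℝ) / 2 := by field_simp

/-- `exp(−(2σ)⁻¹·Σ_b(2 − Re tr v_b))` is integrable for the product Haar probability (measurable, bounded by `1`; `σ > 0`). [folklore] -/
theorem integrable_exp_neg_quadProfile {σ : ℝ} (hσ0 : 0 < σ) :
    Integrable (fun v : B → Matrix.specialUnitaryGroup (Fin 2) ℂ =>
        exp (-((2 * σ)⁻¹ * ∑ b, (2 - (((v b : Matrix.specialUnitaryGroup (Fin 2) ℂ) : Matrix (Fin 2) (Fin 2) ℂ).trace).re))))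
      (Measure.pi fun _ : B => haarProbability (Matrix.specialUnitaryGroup (Fin 2) ℂ)) := by
  refine Integrable.mono' (integrable_const (1 : ℝ)) ?_ (Filter.Eventually.of_forall fun v => ?_)
  · exact (Real.measurable_exp.comp ((measurable_const.mul measurable_traceDeficitSum).neg)).aestronglyMeasurable
  · -- `0 ≤ 2 − Re tr U` on `SU(2)`: it is `‖su2Quat U − 1‖²` (V19; the tree's `CrossoverCertificate.Negative.two_sub_trace_re_nonneg` states it too)
    have hnn : ∀ U : Matrix.specialUnitaryGroup (Fin 2) ℂ, 0 ≤ 2 - ((U : Matrix (Fin 2) (Fin 2) ℂ).trace).re := fun U => by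
      rw [← norm_su2Quat_sub_one_sq]; positivity
    rw [Real.norm_eq_abs, abs_of_pos (exp_pos _), Real.exp_le_one_iff, neg_nonpos]
    exact mul_nonneg (by positivity) (Finset.sum_nonneg fun b _ => hnn (v b))

/-- **THE QUADRATIC PROFILE'S VOLUME LETTER** (`SU(2)` MODEL): for `0 < σ ≤ ¼`, `σ ≤ η` and any inner-window letter `b ≥ −log κ(Π_b W_σ)`,
`−log ∫_{Π W_η} exp(−(2σ)⁻¹Σ_b(2 − Re tr v_b)) dκ ≤ #bonds∕2 + b` — with V26's letter at `σ = g²`: `(3∕2)·log g⁻²` per bond plus `log 160 + ½`,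
print's «`−½d(𝔤)log g_k⁻² + log σ₀`» per degree of freedom with `d(𝔤) = 3`, in print's INTEGRATED shape (1.2)∕(1.10) (`…_rate2` below is the
by-value form available from V19 today). [folklore] -/
theorem neg_log_quadProfileVolume_le {σ η b : ℝ} (hσ0 : 0 < σ) (hσ : σ ≤ 1 / 4) (hση : σ ≤ η)
    (hvol : -Real.log ((Measure.pi fun _ : B => haarProbability (Matrix.specialUnitaryGroup (Fin 2) ℂ))
        (Set.univ.pi fun _ : B => {U : Matrix.specialUnitaryGroup (Fin 2) ℂ | 2 - ((U : Matrix (Fin 2) (Fin 2) ℂ).trace).re ≤ σ})).toReal ≤ b) :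
    -Real.log (∫ v in (Set.univ.pi fun _ : B => {U : Matrix.specialUnitaryGroup (Fin 2) ℂ | 2 - ((U : Matrix (Fin 2) (Fin 2) ℂ).trace).re ≤ η}),
        exp (-((2 * σ)⁻¹ * ∑ b, (2 - (((v b : Matrix.specialUnitaryGroup (Fin 2) ℂ) : Matrix (Fin 2) (Fin 2) ℂ).trace).re)))
          ∂(Measure.pi fun _ : B => haarProbability (Matrix.specialUnitaryGroup (Fin 2) ℂ))) ≤
      (Fintype.card B : ℝ) / 2 + b := by
  have h := neg_log_profileVolume_le (B := B) hσ0 hσ hση hvol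
    (fun v => (2 * σ)⁻¹ * ∑ b, (2 - (((v b : Matrix.specialUnitaryGroup (Fin 2) ℂ) : Matrix (Fin 2) (Fin 2) ℂ).trace).re))
    (fun v hv => quadProfile_le_on_innerWindow hσ0 hv) (integrable_exp_neg_quadProfile hσ0).integrableOn
  linarith

/-! ### §3b The letter is ADDITIVE over the bonds (exact factorisation), and bounded on the other side by the window letter -/

/-- **EXACT FACTORISATION** (product measure, product window, product-form profile): for any s-finite measure `μ` on `SU(2)`, window `s`, one-bond
profile `f` and constant `c`, `∫_{Π_b s} exp(−c·Σ_b f(v_b)) d(⊗_b μ) = (∫_s exp(−c·f) dμ)^{#bonds}` — the volume letter is ADDITIVE over the degrees of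
freedom, print's «per site» in (1.10). (Mathlib's `integral_fintype_prod_eq_pow` on the restricted product measure, `Measure.restrict_pi_pi`.) [folklore] -/
theorem profileVolume_eq_pow (μ : Measure (Matrix.specialUnitaryGroup (Fin 2) ℂ)) [SigmaFinite μ] (s : Set (Matrix.specialUnitaryGroup (Fin 2) ℂ))
    (f : Matrix.specialUnitaryGroup (Fin 2) ℂ → ℝ) (c : ℝ) :
    ∫ v in (Set.univ.pi fun _ : B => s), exp (-(c * ∑ b, f (v b))) ∂(Measure.pi fun _ : B => μ) =
      (∫ u in s, exp (-(c * f u)) ∂μ) ^ Fintype.card B := by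
  rw [Measure.restrict_pi_pi (fun _ : B => μ) (fun _ : B => s)]
  have h : ∀ v : B → Matrix.specialUnitaryGroup (Fin 2) ℂ, exp (-(c * ∑ b, f (v b))) = ∏ b, exp (-(c * f (v b))) := by
    intro v; rw [Finset.mul_sum, ← Real.exp_sum, ← Finset.sum_neg_distrib]
  simp_rw [h]
  exact integral_fintype_prod_eq_pow (𝕜 := ℝ) (μ := μ.restrict s) (fun u => exp (-(c * f u)))

/-- Hence the quadratic trace profile's letter is EXACTLY `#bonds` times the one-bond letter:
`∫_{Π W_η} exp(−(2σ)⁻¹Σ_b(2 − Re tr v_b)) dκ = (∫_{W_η} exp(−(2σ)⁻¹(2 − Re tr u)) dHaar(u))^{#bonds}`. [folklore] -/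
theorem quadProfileVolume_eq_pow (σ η : ℝ) :
    ∫ v in (Set.univ.pi fun _ : B => {U : Matrix.specialUnitaryGroup (Fin 2) ℂ | 2 - ((U : Matrix (Fin 2) (Fin 2) ℂ).trace).re ≤ η}),
        exp (-((2 * σ)⁻¹ * ∑ b, (2 - (((v b : Matrix.specialUnitaryGroup (Fin 2) ℂ) : Matrix (Fin 2) (Fin 2) ℂ).trace).re)))
          ∂(Measure.pi fun _ : B => haarProbability (Matrix.specialUnitaryGroup (Fin 2) ℂ)) =
      (∫ u in {U : Matrix.specialUnitaryGroup (Fin 2) ℂ | 2 - ((U : Matrix (Fin 2) (Fin 2) ℂ).trace).re ≤ η},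
        exp (-((2 * σ)⁻¹ * (2 - ((u : Matrix (Fin 2) (Fin 2) ℂ).trace).re))) ∂(haarProbability (Matrix.specialUnitaryGroup (Fin 2) ℂ))) ^ Fintype.card B :=
  profileVolume_eq_pow _ _ (fun u => 2 - ((u : Matrix (Fin 2) (Fin 2) ℂ).trace).re) _

/-- **THE OTHER SIDE, FROM THE WINDOW LETTER**: a nonnegative profile cannot make the integrated denominator LARGER than the window's mass, so for
`q ≥ 0` on `Π_b W_η` any LOWER letter of the outer window `b′ ≤ −log κ(Π_b W_η)` (V26's `le_neg_log_pi_traceWindow`: `#bonds·((3∕2)·log η⁻¹ − log 12)`)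
bounds the profile letter from below: `b′ ≤ −log ∫_{Π W_η} e^{−q} dκ` — with `neg_log_profileVolume_le`, the profile letter per bond lies between
`(3∕2)·log η⁻¹ − log 12` (outer radius) and `(3∕2)·log σ⁻¹ + log 160 + q₀∕#bonds` (inner radius). [folklore] -/
theorem le_neg_log_profileVolume {η b' : ℝ} (q : (B → Matrix.specialUnitaryGroup (Fin 2) ℂ) → ℝ)
    (hvol' : b' ≤ -Real.log ((Measure.pi fun _ : B => haarProbability (Matrix.specialUnitaryGroup (Fin 2) ℂ))
        (Set.univ.pi fun _ : B => {U : Matrix.specialUnitaryGroup (Fin 2) ℂ | 2 - ((U : Matrix (Fin 2) (Fin 2) ℂ).trace).re ≤ η})).toReal)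
    (hq0 : ∀ v ∈ (Set.univ.pi fun _ : B => {U : Matrix.specialUnitaryGroup (Fin 2) ℂ | 2 - ((U : Matrix (Fin 2) (Fin 2) ℂ).trace).re ≤ η}), 0 ≤ q v)
    (hint : IntegrableOn (fun v => exp (-q v))
      (Set.univ.pi fun _ : B => {U : Matrix.specialUnitaryGroup (Fin 2) ℂ | 2 - ((U : Matrix (Fin 2) (Fin 2) ℂ).trace).re ≤ η})
      (Measure.pi fun _ : B => haarProbability (Matrix.specialUnitaryGroup (Fin 2) ℂ)))
    (hpos : 0 < ∫ v in (Set.univ.pi fun _ : B => {U : Matrix.specialUnitaryGroup (Fin 2) ℂ | 2 - ((U : Matrix (Fin 2) (Fin 2) ℂ).trace).re ≤ η}),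
        exp (-q v) ∂(Measure.pi fun _ : B => haarProbability (Matrix.specialUnitaryGroup (Fin 2) ℂ))) :
    b' ≤ -Real.log (∫ v in (Set.univ.pi fun _ : B => {U : Matrix.specialUnitaryGroup (Fin 2) ℂ | 2 - ((U : Matrix (Fin 2) (Fin 2) ℂ).trace).re ≤ η}),
        exp (-q v) ∂(Measure.pi fun _ : B => haarProbability (Matrix.specialUnitaryGroup (Fin 2) ℂ))) := by
  set κ : Measure (B → Matrix.specialUnitaryGroup (Fin 2) ℂ) := Measure.pi fun _ : B => haarProbability (Matrix.specialUnitaryGroup (Fin 2) ℂ)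
    with hκ
  set W : Set (B → Matrix.specialUnitaryGroup (Fin 2) ℂ) :=
    Set.univ.pi fun _ : B => {U : Matrix.specialUnitaryGroup (Fin 2) ℂ | 2 - ((U : Matrix (Fin 2) (Fin 2) ℂ).trace).re ≤ η} with hW
  have hWm : MeasurableSet W := MeasurableSet.univ_pi fun _ => measurableSet_traceWindow η
  -- `∫_W e^{−q} ≤ ∫_W 1 = κ(W)`
  have hle : ∫ v in W, exp (-q v) ∂κ ≤ (κ W).toReal := by
    have h1 : ∫ v in W, exp (-q v) ∂κ ≤ ∫ v in W, (1 : ℝ) ∂κ :=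
      setIntegral_mono_on hint (integrableOn_const (measure_ne_top _ _)) hWm fun v hv => by
        rw [Real.exp_le_one_iff]; linarith [hq0 v hv]
    rwa [setIntegral_const, smul_eq_mul, mul_one, measureReal_def] at h1
  have hlog := Real.log_le_log hpos hle
  linarith

end SU2

/-! ## §4 The junction: V25 §2b's creation price in profile shape, with the denominator's letter folded in -/

section Junction

variable {B : Type*} [Fintype B] {Y : Type*} [MeasurableSpace Y] (μ : Measure Y) [SFinite μ]

/-- **THE CREATION-STEP PRICE IN PRINT'S PROFILE SHAPE, LETTER VALUED** (`SU(2)` MODEL): near fibre `bonds → SU(2)`, product Haar `κ`, far space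
`(Y, μ)`; `F, G, w ≥ 0`; `G ≥ 1` on the centred window `U₀(y)·Π_b W_η` (`hGwin`), the interaction exceeds the base level `m₀ y` there by at most a PROFILE
`q` of the relative position (`hIprof`), `q ≤ q₀` on the inner window `Π_b W_σ` (`0 < σ ≤ ¼`, `σ ≤ η`), `e^{−q}` integrable on `Π_b W_η`; `F` lives where
SOME bond is at quaternion distance `≥ δ′` from the centre (`hF`), bond-quadratic floor of modulus `λ` there (`hconv`); `b ≥ −log κ(Π_b W_σ)`.  Then
`∫ F·w·e^{−I} ≤ exp(−(λ∕2)δ′² + q₀ + b)·(∫F dκ)·∫ G·w·e^{−I}` (leaf-01's `relFibre_moment_le_of_centredProfile` at the level `m₀ + (λ∕2)δ′²`, profile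
`q − (λ∕2)δ′²` — V25 §2b's trick — then §2; with V26's letter: `−(λ∕2)δ′² + q₀ + #bonds·((3∕2)·log σ⁻¹ + log 160)`). [folklore] -/
theorem creationPrice_SU2_profile_valued {σ η q₀ b : ℝ} (hσ0 : 0 < σ) (hσ : σ ≤ 1 / 4) (hση : σ ≤ η)
    (hvol : -Real.log ((Measure.pi fun _ : B => haarProbability (Matrix.specialUnitaryGroup (Fin 2) ℂ))
        (Set.univ.pi fun _ : B => {U : Matrix.specialUnitaryGroup (Fin 2) ℂ | 2 - ((U : Matrix (Fin 2) (Fin 2) ℂ).trace).re ≤ σ})).toReal ≤ b)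
    (F G : (B → Matrix.specialUnitaryGroup (Fin 2) ℂ) → ℝ) (w : Y → ℝ) (I : (B → Matrix.specialUnitaryGroup (Fin 2) ℂ) × Y → ℝ) (m₀ : Y → ℝ)
    (U₀ : Y → (B → Matrix.specialUnitaryGroup (Fin 2) ℂ)) (q : (B → Matrix.specialUnitaryGroup (Fin 2) ℂ) → ℝ) {lam δ' : ℝ}
    (hF0 : ∀ x, 0 ≤ F x) (hG0 : ∀ x, 0 ≤ G x) (hw0 : ∀ y, 0 ≤ w y) (hlam : 0 ≤ lam) (hδ : 0 ≤ δ')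
    (hq : ∀ v ∈ (Set.univ.pi fun _ : B => {U : Matrix.specialUnitaryGroup (Fin 2) ℂ | 2 - ((U : Matrix (Fin 2) (Fin 2) ℂ).trace).re ≤ σ}), q v ≤ q₀)
    (hint : IntegrableOn (fun v => exp (-q v))
      (Set.univ.pi fun _ : B => {U : Matrix.specialUnitaryGroup (Fin 2) ℂ | 2 - ((U : Matrix (Fin 2) (Fin 2) ℂ).trace).re ≤ η})
      (Measure.pi fun _ : B => haarProbability (Matrix.specialUnitaryGroup (Fin 2) ℂ)))
    (hF : ∀ x y, F x ≠ 0 → w y ≠ 0 → ∃ b : B, δ' ≤ ‖su2Quat ((U₀ y b)⁻¹ * x b) - 1‖)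
    (hconv : ∀ x y, F x ≠ 0 → w y ≠ 0 → m₀ y + lam / 2 * ∑ b, ‖su2Quat ((U₀ y b)⁻¹ * x b) - 1‖ ^ 2 ≤ I (x, y))
    (hGwin : ∀ y v, w y ≠ 0 → v ∈ (Set.univ.pi fun _ : B => {U : Matrix.specialUnitaryGroup (Fin 2) ℂ | 2 - ((U : Matrix (Fin 2) (Fin 2) ℂ).trace).re ≤ η}) →
      1 ≤ G (U₀ y * v))
    (hIprof : ∀ y v, w y ≠ 0 → v ∈ (Set.univ.pi fun _ : B => {U : Matrix.specialUnitaryGroup (Fin 2) ℂ | 2 - ((U : Matrix (Fin 2) (Fin 2) ℂ).trace).re ≤ η}) →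
      I (U₀ y * v, y) ≤ m₀ y + q v)
    (hFi : Integrable F (Measure.pi fun _ : B => haarProbability (Matrix.specialUnitaryGroup (Fin 2) ℂ)))
    (hGI : ∀ y, w y ≠ 0 → Integrable (fun x => G x * exp (-I (x, y))) (Measure.pi fun _ : B => haarProbability (Matrix.specialUnitaryGroup (Fin 2) ℂ)))
    (hA' : Integrable (fun z : (B → Matrix.specialUnitaryGroup (Fin 2) ℂ) × Y => F z.1 * w z.2 * exp (-I z)) ((Measure.pi fun _ : B => haarProbability (Matrix.specialUnitaryGroup (Fin 2) ℂ)).prod μ))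
    (hB' : Integrable (fun z : (B → Matrix.specialUnitaryGroup (Fin 2) ℂ) × Y => G z.1 * w z.2 * exp (-I z)) ((Measure.pi fun _ : B => haarProbability (Matrix.specialUnitaryGroup (Fin 2) ℂ)).prod μ)) :
    ∫ z, F z.1 * w z.2 * exp (-I z) ∂((Measure.pi fun _ : B => haarProbability (Matrix.specialUnitaryGroup (Fin 2) ℂ)).prod μ) ≤
      exp (-(lam / 2 * δ' ^ 2) + q₀ + b) *
        (∫ x, F x ∂(Measure.pi fun _ : B => haarProbability (Matrix.specialUnitaryGroup (Fin 2) ℂ))) * ∫ z, G z.1 * w z.2 * exp (-I z) ∂((Measure.pi fun _ : B => haarProbability (Matrix.specialUnitaryGroup (Fin 2) ℂ)).prod μ) := by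
  set κ : Measure (B → Matrix.specialUnitaryGroup (Fin 2) ℂ) := Measure.pi fun _ : B => haarProbability (Matrix.specialUnitaryGroup (Fin 2) ℂ)
    with hκ
  set W : Set (B → Matrix.specialUnitaryGroup (Fin 2) ℂ) :=
    Set.univ.pi fun _ : B => {U : Matrix.specialUnitaryGroup (Fin 2) ℂ | 2 - ((U : Matrix (Fin 2) (Fin 2) ℂ).trace).re ≤ η} with hW
  set a : ℝ := lam / 2 * δ' ^ 2 with ha
  have hWm : MeasurableSet W := MeasurableSet.univ_pi fun _ => measurableSet_traceWindow η
  have hDpos : 0 < ∫ v in W, exp (-q v) ∂κ := profileVolume_pos hσ0 hσ hση q hq hint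
  have hletter : -Real.log (∫ v in W, exp (-q v) ∂κ) ≤ q₀ + b :=
    neg_log_profileVolume_le hσ0 hσ hση hvol q hq hint
  -- the shifted profile integrates to `e^{a}` times the profile's mass
  have hsplit : ∫ v in W, exp (-(q v - a)) ∂κ = exp a * ∫ v in W, exp (-q v) ∂κ := by
    rw [← integral_const_mul]
    refine integral_congr_ae (ae_of_all _ fun v => ?_)
    show exp (-(q v - a)) = exp a * exp (-q v)
    rw [← Real.exp_add]; ring_nf
  have hqpos' : 0 < ∫ v in W, exp (-(q v - a)) ∂κ := by rw [hsplit]; positivity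
  have hnum : ∀ x y, F x ≠ 0 → w y ≠ 0 → m₀ y + a ≤ I (x, y) := by
    intro x y hx hy
    obtain ⟨b, hb⟩ := hF x y hx hy
    have hsq : δ' ^ 2 ≤ ∑ b, ‖su2Quat ((U₀ y b)⁻¹ * x b) - 1‖ ^ 2 := (pow_le_pow_left₀ hδ hb 2).trans
      (Finset.single_le_sum (f := fun b => ‖su2Quat ((U₀ y b)⁻¹ * x b) - 1‖ ^ 2) (fun b _ => sq_nonneg _) (Finset.mem_univ b))
    have := mul_le_mul_of_nonneg_left hsq (by positivity : 0 ≤ lam / 2)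
    rw [ha]; linarith [hconv x y hx hy]
  have hIprof' : ∀ y v, w y ≠ 0 → v ∈ W → I (U₀ y * v, y) ≤ (m₀ y + a) + (q v - a) := by
    intro y v hy hv; have := hIprof y v hy hv; linarith
  have key := relFibre_moment_le_of_centredProfile κ μ F G w I (fun y => m₀ y + a) U₀ W (fun v => q v - a) hF0 hG0 hw0 hWm hqpos'
    hnum hGwin hIprof' hFi hGI hA' hB'
  rw [hsplit] at key
  -- fold the denominator: `(exp a · D)⁻¹ ≤ exp(−a + letter)`
  have hFint : 0 ≤ ∫ x, F x ∂κ := integral_nonneg hF0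
  have hint' : 0 ≤ ∫ z, G z.1 * w z.2 * exp (-I z) ∂(κ.prod μ) :=
    integral_nonneg fun z => mul_nonneg (mul_nonneg (hG0 _) (hw0 _)) (exp_pos _).le
  have hDinv : (exp a * ∫ v in W, exp (-q v) ∂κ)⁻¹ ≤ exp (-a + (q₀ + b)) := by
    rw [mul_inv, ← Real.exp_neg, Real.exp_add]
    refine mul_le_mul_of_nonneg_left ?_ (exp_pos _).le
    rw [← Real.exp_log hDpos, ← Real.exp_neg]
    exact Real.exp_le_exp.2 hletter
  have hstep : (∫ x, F x ∂κ) / (exp a * ∫ v in W, exp (-q v) ∂κ) ≤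
      exp (-a + q₀ + b) * ∫ x, F x ∂κ := by
    rw [div_eq_mul_inv, mul_comm, show -a + q₀ + b = -a + (q₀ + b) by ring]
    exact mul_le_mul_of_nonneg_right hDinv hFint
  exact key.trans (mul_le_mul_of_nonneg_right hstep hint')

/-- **THE SAME AT THE QUADRATIC TRACE PROFILE** (`SU(2)` MODEL, every volume letter valued): if on the centred window the interaction exceeds the base
level by at most `(2σ)⁻¹·Σ_b(2 − Re tr v_b)` — the model of `½g_k⁻²|B′|²` at `σ = g_k²`, [B16] (1.2)'s Gaussian — then, with `0 < σ ≤ ¼`, `σ ≤ η` and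
any inner-window letter `b`, `∫ F·w·e^{−I} ≤ exp(−(λ∕2)δ′² + #bonds∕2 + b)·(∫F dκ)·∫ G·w·e^{−I}` (with V26's letter:
`exp(−(λ∕2)δ′² + #bonds·((3∕2)·log σ⁻¹ + log 160 + ½))`). [folklore] -/
theorem creationPrice_SU2_quadProfile_valued {σ η b : ℝ} (hσ0 : 0 < σ) (hσ : σ ≤ 1 / 4) (hση : σ ≤ η)
    (hvol : -Real.log ((Measure.pi fun _ : B => haarProbability (Matrix.specialUnitaryGroup (Fin 2) ℂ))
        (Set.univ.pi fun _ : B => {U : Matrix.specialUnitaryGroup (Fin 2) ℂ | 2 - ((U : Matrix (Fin 2) (Fin 2) ℂ).trace).re ≤ σ})).toReal ≤ b)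
    (F G : (B → Matrix.specialUnitaryGroup (Fin 2) ℂ) → ℝ) (w : Y → ℝ) (I : (B → Matrix.specialUnitaryGroup (Fin 2) ℂ) × Y → ℝ) (m₀ : Y → ℝ)
    (U₀ : Y → (B → Matrix.specialUnitaryGroup (Fin 2) ℂ)) {lam δ' : ℝ}
    (hF0 : ∀ x, 0 ≤ F x) (hG0 : ∀ x, 0 ≤ G x) (hw0 : ∀ y, 0 ≤ w y) (hlam : 0 ≤ lam) (hδ : 0 ≤ δ')
    (hF : ∀ x y, F x ≠ 0 → w y ≠ 0 → ∃ b : B, δ' ≤ ‖su2Quat ((U₀ y b)⁻¹ * x b) - 1‖)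
    (hconv : ∀ x y, F x ≠ 0 → w y ≠ 0 → m₀ y + lam / 2 * ∑ b, ‖su2Quat ((U₀ y b)⁻¹ * x b) - 1‖ ^ 2 ≤ I (x, y))
    (hGwin : ∀ y v, w y ≠ 0 → v ∈ (Set.univ.pi fun _ : B => {U : Matrix.specialUnitaryGroup (Fin 2) ℂ | 2 - ((U : Matrix (Fin 2) (Fin 2) ℂ).trace).re ≤ η}) →
      1 ≤ G (U₀ y * v))
    (hIprof : ∀ y v, w y ≠ 0 → v ∈ (Set.univ.pi fun _ : B => {U : Matrix.specialUnitaryGroup (Fin 2) ℂ | 2 - ((U : Matrix (Fin 2) (Fin 2) ℂ).trace).re ≤ η}) →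
      I (U₀ y * v, y) ≤ m₀ y + (2 * σ)⁻¹ * ∑ b, (2 - (((v b : Matrix.specialUnitaryGroup (Fin 2) ℂ) : Matrix (Fin 2) (Fin 2) ℂ).trace).re))
    (hFi : Integrable F (Measure.pi fun _ : B => haarProbability (Matrix.specialUnitaryGroup (Fin 2) ℂ)))
    (hGI : ∀ y, w y ≠ 0 → Integrable (fun x => G x * exp (-I (x, y))) (Measure.pi fun _ : B => haarProbability (Matrix.specialUnitaryGroup (Fin 2) ℂ)))
    (hA' : Integrable (fun z : (B → Matrix.specialUnitaryGroup (Fin 2) ℂ) × Y => F z.1 * w z.2 * exp (-I z)) ((Measure.pi fun _ : B => haarProbability (Matrix.specialUnitaryGroup (Fin 2) ℂ)).prod μ))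
    (hB' : Integrable (fun z : (B → Matrix.specialUnitaryGroup (Fin 2) ℂ) × Y => G z.1 * w z.2 * exp (-I z)) ((Measure.pi fun _ : B => haarProbability (Matrix.specialUnitaryGroup (Fin 2) ℂ)).prod μ)) :
    ∫ z, F z.1 * w z.2 * exp (-I z) ∂((Measure.pi fun _ : B => haarProbability (Matrix.specialUnitaryGroup (Fin 2) ℂ)).prod μ) ≤
      exp (-(lam / 2 * δ' ^ 2) + (Fintype.card B : ℝ) / 2 + b) *
        (∫ x, F x ∂(Measure.pi fun _ : B => haarProbability (Matrix.specialUnitaryGroup (Fin 2) ℂ))) * ∫ z, G z.1 * w z.2 * exp (-I z) ∂((Measure.pi fun _ : B => haarProbability (Matrix.specialUnitaryGroup (Fin 2) ℂ)).prod μ) :=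
  creationPrice_SU2_profile_valued μ hσ0 hσ hση hvol F G w I m₀ U₀
    (fun v => (2 * σ)⁻¹ * ∑ b, (2 - (((v b : Matrix.specialUnitaryGroup (Fin 2) ℂ) : Matrix (Fin 2) (Fin 2) ℂ).trace).re)) hF0 hG0 hw0 hlam hδ
    (fun _ hv => quadProfile_le_on_innerWindow hσ0 hv) (integrable_exp_neg_quadProfile hσ0).integrableOn hF hconv hGwin hIprof hFi hGI hA' hB'

end Junction

/-! ## §5 Sanity, and the Gaussian trace action as a NON-VACUOUS instance of §4's two action hypotheses -/

section Instance

variable {B : Type*} [Fintype B] {Y : Type*}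

/-- **THE MODEL GAUSSIAN TRACE ACTION MEETS `hconv` WITH EQUALITY** (`λ = σ⁻¹`): for
`I(x, y) := m₀ y + (2σ)⁻¹·Σ_b (2 − Re tr((U₀ y b)⁻¹ x b))` one has `m₀ y + (σ⁻¹∕2)·Σ_b ‖su2Quat((U₀ y b)⁻¹ x b) − 1‖² ≤ I(x, y)` (V19's
`norm_su2Quat_sub_one_sq`). [folklore] -/
theorem quadAction_hconv (σ : ℝ) (m₀ : Y → ℝ) (U₀ : Y → (B → Matrix.specialUnitaryGroup (Fin 2) ℂ))
    (x : B → Matrix.specialUnitaryGroup (Fin 2) ℂ) (y : Y) :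
    m₀ y + σ⁻¹ / 2 * ∑ b, ‖su2Quat ((U₀ y b)⁻¹ * x b) - 1‖ ^ 2 ≤
      m₀ y + (2 * σ)⁻¹ * ∑ b, (2 - ((((U₀ y b)⁻¹ * x b : Matrix.specialUnitaryGroup (Fin 2) ℂ) : Matrix (Fin 2) (Fin 2) ℂ).trace).re) := by
  simp_rw [norm_su2Quat_sub_one_sq]
  rw [mul_inv, show (2 : ℝ)⁻¹ * σ⁻¹ = σ⁻¹ / 2 by ring]

/-- **… AND `hIprof` WITH EQUALITY**: on the centred window point `U₀ y · v` the same action reads `m₀ y + (2σ)⁻¹·Σ_b (2 − Re tr v_b)` — the relative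
position only (`(U₀ y b)⁻¹(U₀ y · v) b = v b`). [folklore] -/
theorem quadAction_hIprof (σ : ℝ) (m₀ : Y → ℝ) (U₀ : Y → (B → Matrix.specialUnitaryGroup (Fin 2) ℂ))
    (y : Y) (v : B → Matrix.specialUnitaryGroup (Fin 2) ℂ) :
    m₀ y + (2 * σ)⁻¹ * ∑ b, (2 - ((((U₀ y b)⁻¹ * (U₀ y * v) b : Matrix.specialUnitaryGroup (Fin 2) ℂ) : Matrix (Fin 2) (Fin 2) ℂ).trace).re) ≤
      m₀ y + (2 * σ)⁻¹ * ∑ b, (2 - (((v b : Matrix.specialUnitaryGroup (Fin 2) ℂ) : Matrix (Fin 2) (Fin 2) ℂ).trace).re) := by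
  simp_rw [Pi.mul_apply, inv_mul_cancel_left]
  exact le_rfl

end Instance


/-! ## §6 By value today: the rate-`2` letter of V19 plugged in (the rate-`3∕2` letter of V26 plugs in the same way) -/

/-- **THE QUADRATIC PROFILE LETTER BY VALUE, RATE 2** (V19's `neg_log_pi_traceWindow_le` as the inner-window letter; V26's `…_le_sharp` in its place
gives `#bonds·((3∕2)·log σ⁻¹ + log 160 + ½)` by the same line): `−log ∫_{Π W_η} exp(−(2σ)⁻¹Σ_b(2 − Re tr v_b)) dκ ≤ #bonds·(2 log σ⁻¹ + log 16 + ½)`. [folklore] -/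
theorem neg_log_quadProfileVolume_le_rate2 {B : Type*} [Fintype B] {σ η : ℝ} (hσ0 : 0 < σ) (hσ : σ ≤ 1 / 4) (hση : σ ≤ η) :
    -Real.log (∫ v in (Set.univ.pi fun _ : B => {U : Matrix.specialUnitaryGroup (Fin 2) ℂ | 2 - ((U : Matrix (Fin 2) (Fin 2) ℂ).trace).re ≤ η}),
        exp (-((2 * σ)⁻¹ * ∑ b, (2 - (((v b : Matrix.specialUnitaryGroup (Fin 2) ℂ) : Matrix (Fin 2) (Fin 2) ℂ).trace).re)))
          ∂(Measure.pi fun _ : B => haarProbability (Matrix.specialUnitaryGroup (Fin 2) ℂ))) ≤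
      (Fintype.card B : ℝ) * (2 * Real.log σ⁻¹ + Real.log 16 + 1 / 2) := by
  have h := neg_log_quadProfileVolume_le (B := B) hσ0 hσ hση (neg_log_pi_traceWindow_le hσ0 hσ)
  linarith

end Summit.QuantumFields.BalabanUV.T4Continuum.NE7b.CompactFibreProfileVolumeSU2

end
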